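import Summits.AtomisticToContinuum.Crystallization.Theorems.FrustratedLawDichotomyCellTflatData

/-!
# FrustratedLawDichotomy · crux `AperiodicFrustratedLawGap` (stmt-AtomisticToContinuum-27623) — T′♭₄₅ witness cell: class checks 8–11
# (decomp-a2c, prover hand 1, generation 15; kernel evaluations of `Cell.checkClassBad`, split for build time)

Each theorem is ONE `decide +kernel` of `cellT.checkClassBad m (cellTCert m)`: nn witness, far witness at `≥ 9/8·d`, the 11664-point pinning scan and
the class site-sum bound.  [folklore]
-/

namespace Summit.AtomisticToContinuum.Crystallization.Theorems.FrustratedLawDichotomyCellTflatCeiling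

open Summit.AtomisticToContinuum.Crystallization.Theorems.FrustratedLawDichotomyCellChecker


set_option maxHeartbeats 0 in
/-- Class `8` of `cellT` passes `checkClassBad` (kernel evaluation). [folklore] -/
theorem cellT_checkClass8 : cellT.checkClassBad ⟨8, by decide⟩ (cellTCert 8) = true := by decide +kernel

set_option maxHeartbeats 0 in
/-- Class `9` of `cellT` passes `checkClassBad` (kernel evaluation). [folklore] -/
theorem cellT_checkClass9 : cellT.checkClassBad ⟨9, by decide⟩ (cellTCert 9) = true := by decide +kernel

set_option maxHeartbeats 0 in
/-- Class `10` of `cellT` passes `checkClassBad` (kernel evaluation). [folklore] -/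
theorem cellT_checkClass10 : cellT.checkClassBad ⟨10, by decide⟩ (cellTCert 10) = true := by decide +kernel

set_option maxHeartbeats 0 in
/-- Class `11` of `cellT` passes `checkClassBad` (kernel evaluation). [folklore] -/
theorem cellT_checkClass11 : cellT.checkClassBad ⟨11, by decide⟩ (cellTCert 11) = true := by decide +kernel

end Summit.AtomisticToContinuum.Crystallization.Theorems.FrustratedLawDichotomyCellTflatCeiling
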